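import Summits.SmoothPoincare4.SmoothPoincare4.Theses.EntropyRung
import Summits.SmoothPoincare4.SmoothPoincare4.Theorems.EntropyRungSubcylindricalExistenceSphereSideClauseAux
import Summits.SmoothPoincare4.SmoothPoincare4.Theorems.EntropyRungSubcylindricalExistenceCapFactorRound
import Summits.SmoothPoincare4.SmoothPoincare4.Theorems.EntropyRungSubcylindricalExistenceGradSqFlatChart
import HarnessLib

/-!
# Helpers for stub `stub_sphereSideClauseSchwarzschild` (S2'M, line
`green-blowup-conformal-entropy`, reshape R-c3 "Schwarzschild gauge", crux
`EntropyRung.SubcylindricalExistence`, item stmt-SmoothPoincare4-10871): the cap with mass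

Pointwise and chart-level lemmas for the cap side of the conformal gluing in the flat gauge WITH
MASS (`G ∘ φ⁻¹ = a/‖y − y₀‖² + b` on the punctured flat ball, `a > 0`, `b ≥ 0` constant; companion
file `EntropyRungSubcylindricalExistenceSphereSideClauseSchwarzschild.lean`), the `+b` variants of
lead c2's `SphereSideClauseAux` lemmas: the one-variable cap inequality `cap_algebra_mass` (with
`s = G = a/n + b`, `n s = a + bn`: `ψ⁻³ (R ψ − 6(θ''·4a²/n³ + θ'·R s/6)) ≥ 12a²/(K(a + bn)³)`,
`θ(s) = 4K − 16K²/(4K+s)` the Möbius profile, `ψ = θ(s) = 4Ks/(4K+s)`); continuity of the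
`ψ`-weighted Perelman density with a curvature weight that is only continuous on the chart source
(`continuous_mul_sq_of_tsupport_subset`, `continuous_density'`);
`ψ ∘ φ⁻¹ = 4K(a + b‖y−y₀‖²)/((4K+b)‖y−y₀‖² + a)` on the flat ball (`psi_chart_mass`); and the
registered helper `helper_sphereSideCurvBoundSchwarzschild` (= `curv_bound_mass`): the curvature
weight bound `ψ⁻³ (R_g ψ − 6Δ_g ψ) ≥ 12a²/(K(a + b‖y − y₀‖²)³)` on the punctured flat ball, from the
chain rule `dalembertian_real_comp`, the Green equation, `θ(s) − sθ'(s) = 4Ks²/(4K+s)² ≥ 0`,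
`R_g ≥ 0`, and `|∇G|²_g = ‖∇(a/‖·−y₀‖² + b)‖² = 4a²/‖y−y₀‖⁶` (landed flat-chart gradient identity
`gradSq_extChartAt_symm_of_flat`, stub S0). References: Schoen 1984 (flat conformal gauge,
`G = a/|y|² + A + O(|y|)`); Lee–Parker 1987, §3 and §6; O'Neill 1983, Ch. 3 (chain rule for
`Δ_g`). [folklore]
-/

noncomputable section

-- the registered namespace `Summit.SmoothPoincare4.SmoothPoincare4.Theorems` repeats a component
set_option linter.dupNamespace false

open scoped Manifold ContDiff Topology RealInnerProductSpace
open Set Filter MeasureTheory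
open Literature.Geometry.Lorentzian Literature.Geometry.Riemannian

namespace Summit.SmoothPoincare4.SmoothPoincare4.Theorems

namespace SphereSideClauseSchwarzschild

open SphereSideClause CapFactorRound

/-! ### One-variable algebra of the cap with mass -/

/-- The pointwise algebra of the cap with mass: with `s = G = a/n + b`, `|∇G|² = 4a²/n³`,
`ψ = 4Ks/(4K+s)`, `θ' = 16K²/(4K+s)²`, `θ'' = −32K²/(4K+s)³` and `R ≥ 0`,
`ψ⁻³ (R ψ − 6(θ''|∇G|² + θ' · R s/6)) ≥ 12a²/(K(a + bn)³)` (equality for `R = 0`; the case `b = 0`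
is `SphereSideClause.cap_algebra`). [folklore] -/
theorem cap_algebra_mass {K a b n R : ℝ} (hK : 0 < K) (ha : 0 < a) (hb : 0 ≤ b) (hn : 0 < n)
    (hR : 0 ≤ R) :
    12 * a ^ 2 / (K * (a + b * n) ^ 3) ≤ ((4 * K * (a / n + b) / (4 * K + (a / n + b))) ^ 3)⁻¹ *
      (R * (4 * K * (a / n + b) / (4 * K + (a / n + b))) -
        6 * (-(32 * K ^ 2) * ((4 * K + (a / n + b)) ^ 3)⁻¹ * (4 * a ^ 2 / n ^ 3) +
          16 * K ^ 2 * ((4 * K + (a / n + b)) ^ 2)⁻¹ * (R * (a / n + b) / 6))) := by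
  have hs : 0 < a / n + b := by positivity
  have hsn : a + b * n = (a / n + b) * n := by field_simp
  set s := a / n + b with hs_def
  have h4Ks : 0 < 4 * K + s := by positivity
  have key : ((4 * K * s / (4 * K + s)) ^ 3)⁻¹ *
      (-(6 * (-(32 * K ^ 2) * ((4 * K + s) ^ 3)⁻¹ * (4 * a ^ 2 / n ^ 3)))) =
      12 * a ^ 2 / (K * (a + b * n) ^ 3) := by
    rw [hsn]
    field_simp
    ring
  have hRpart : 0 ≤ ((4 * K * s / (4 * K + s)) ^ 3)⁻¹ * (R * (4 * K * s / (4 * K + s)) -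
      6 * (16 * K ^ 2 * ((4 * K + s) ^ 2)⁻¹ * (R * s / 6))) := by
    have : R * (4 * K * s / (4 * K + s)) - 6 * (16 * K ^ 2 * ((4 * K + s) ^ 2)⁻¹ * (R * s / 6))
        = R * (4 * K * s ^ 2 / (4 * K + s) ^ 2) := by
      field_simp
      ring
    rw [this]
    positivity
  have hsplit : ((4 * K * s / (4 * K + s)) ^ 3)⁻¹ *
      (R * (4 * K * s / (4 * K + s)) -
        6 * (-(32 * K ^ 2) * ((4 * K + s) ^ 3)⁻¹ * (4 * a ^ 2 / n ^ 3) +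
          16 * K ^ 2 * ((4 * K + s) ^ 2)⁻¹ * (R * s / 6))) =
      ((4 * K * s / (4 * K + s)) ^ 3)⁻¹ * (R * (4 * K * s / (4 * K + s)) -
        6 * (16 * K ^ 2 * ((4 * K + s) ^ 2)⁻¹ * (R * s / 6))) +
      ((4 * K * s / (4 * K + s)) ^ 3)⁻¹ *
        (-(6 * (-(32 * K ^ 2) * ((4 * K + s) ^ 3)⁻¹ * (4 * a ^ 2 / n ^ 3)))) := by ring
  rw [hsplit, key]
  linarith [hRpart]

/-! ### Continuity with a weight that is only continuous on the chart source -/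

/-- A product `ρ · w²` with `ρ` continuous on the open set `U` and `w` continuous with
`tsupport w ⊆ U` is continuous. [folklore] -/
theorem continuous_mul_sq_of_tsupport_subset {X : Type*} [TopologicalSpace X] {U : Set X}
    (hU : IsOpen U) {ρ w : X → ℝ} (hρ : ContinuousOn ρ U) (hw : Continuous w)
    (hwU : tsupport w ⊆ U) : Continuous fun x ↦ ρ x * w x ^ 2 := by
  refine continuous_iff_continuousAt.2 fun x ↦ ?_
  by_cases hx : x ∈ U
  · exact (hρ.continuousAt (hU.mem_nhds hx)).mul (hw.pow 2).continuousAt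
  · have hev : (fun x ↦ ρ x * w x ^ 2) =ᶠ[𝓝 x] fun _ ↦ (0 : ℝ) := by
      filter_upwards [(isClosed_tsupport w).isOpen_compl.mem_nhds fun h ↦ hx (hwU h)] with y hy
      rw [image_eq_zero_of_notMem_tsupport hy, zero_pow two_ne_zero, mul_zero]
    exact continuousAt_const.congr_of_eventuallyEq hev

/-- Continuity of the `ψ`-weighted Perelman density with a frozen curvature weight `ρ` for which
only `ρ · w²` is known to be continuous (variant of `SphereSideClause.continuous_density`).
[folklore] -/
theorem continuous_density' {X : Type*} [TopologicalSpace X] {ρ w q ψ : X → ℝ}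
    (hρw : Continuous fun x ↦ ρ x * w x ^ 2) (hw : Continuous w) (hq : Continuous q)
    (hψ : Continuous ψ) (hψ0 : ∀ x, ψ x ≠ 0) (τ c : ℝ) :
    Continuous fun x ↦ (τ * (ρ x * w x ^ 2 + 4 * ((ψ x)⁻¹ ^ 2 * q x))
      - w x ^ 2 * Real.log (w x ^ 2) - 4 * w x ^ 2) * (c * ψ x ^ 4) := by
  have hlog : Continuous fun x ↦ w x ^ 2 * Real.log (w x ^ 2) :=
    Real.continuous_mul_log.comp (hw.pow 2)
  have hinv : Continuous fun x ↦ (ψ x)⁻¹ := hψ.inv₀ hψ0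
  exact ((((continuous_const.mul (hρw.add
    (continuous_const.mul ((hinv.pow 2).mul hq)))).sub hlog).sub
    (continuous_const.mul (hw.pow 2))).mul (continuous_const.mul (hψ.pow 4)))

/-! ### `ψ` in the chart and the curvature weight of the cap with mass -/

section Cap

variable {M : Type} [TopologicalSpace M] [ChartedSpace (EuclideanSpace ℝ (Fin 4)) M]

/-- In the chart, `ψ ∘ φ⁻¹ (y) = 4K(a + b‖y − y₀‖²)/((4K+b)‖y − y₀‖² + a)` on the closed flat ball
(the `+b` variant of `SphereSideClause.psi_chart`). [folklore] -/
theorem psi_chart_mass (p : M) {G ψ : M → ℝ} {a b r K : ℝ} (ha : 0 < a)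
    (hball : Metric.closedBall (extChartAt (𝓡 4) p p) r ⊆ (extChartAt (𝓡 4) p).target)
    (hGchart : ∀ y ∈ Metric.closedBall (extChartAt (𝓡 4) p p) r, y ≠ extChartAt (𝓡 4) p p →
      G ((extChartAt (𝓡 4) p).symm y) = a / ‖y - extChartAt (𝓡 4) p p‖ ^ 2 + b)
    (hψ : ∀ x, x ≠ p → ψ x = 4 * K * G x / (4 * K + G x)) (hψp : ψ p = 4 * K)
    {y : EuclideanSpace ℝ (Fin 4)} (hy : y ∈ Metric.closedBall (extChartAt (𝓡 4) p p) r) :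
    ψ ((extChartAt (𝓡 4) p).symm y) =
      4 * K * (a + b * ‖y - extChartAt (𝓡 4) p p‖ ^ 2) /
        ((4 * K + b) * ‖y - extChartAt (𝓡 4) p p‖ ^ 2 + a) := by
  by_cases hy0 : y = extChartAt (𝓡 4) p p
  · rw [hy0, extChartAt_to_inv, hψp, sub_self, norm_zero, zero_pow two_ne_zero, mul_zero,
      mul_zero, add_zero, zero_add, mul_div_assoc, div_self ha.ne', mul_one]
  · have hx : (extChartAt (𝓡 4) p).symm y ≠ p := extChartAt_symm_ne_pole (hball hy) hy0
    have hn : ‖y - extChartAt (𝓡 4) p p‖ ≠ 0 := norm_ne_zero_iff.2 (sub_ne_zero.2 hy0)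
    rw [hψ _ hx, hGchart y hy hy0]
    field_simp
    ring

variable [T2Space M] [IsManifold (𝓡 4) ∞ M]
  (g : PseudoRiemannianMetric (𝓡 4) ∞ (EuclideanSpace ℝ (Fin 4)) (TangentSpace (𝓡 4) : M → Type _))
  [g.HasLeviCivita]

/-- **`ψ⁻³ L_g ψ ≥ 12a²/(K(a + b‖y − y₀‖²)³)` on the punctured flat ball** (the `+b` variant of
`SphereSideClause.curv_bound`): off `p`, `ψ = θ ∘ G`, so
`L_g ψ = R(θ(G) − Gθ'(G)) − 6θ''(G)|∇G|²` (chain rule `dalembertian_real_comp`, Green equation),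
`|∇G|² = ‖∇(a/‖·−y₀‖² + b)‖² = 4a²/‖y − y₀‖⁶` by the landed flat-chart gradient identity
`gradSq_extChartAt_symm_of_flat` (S0), and `cap_algebra_mass`. [folklore] -/
theorem curv_bound_mass {p : M} (hR : ∀ x, 0 ≤ g.scalarCurvature x) {G : M → ℝ}
    (hGs : ContMDiffOn (𝓡 4) 𝓘(ℝ, ℝ) ∞ G {p}ᶜ) (hGpos : ∀ x, x ≠ p → 0 < G x)
    (hGreen : ∀ x, x ≠ p → g.scalarCurvature x * G x - 6 * g.dalembertian G x = 0)
    {a b r : ℝ} (ha : 0 < a) (hb : 0 ≤ b)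
    (hball : Metric.closedBall (extChartAt (𝓡 4) p p) r ⊆ (extChartAt (𝓡 4) p).target)
    (hflat : ∀ y ∈ Metric.closedBall (extChartAt (𝓡 4) p p) r, ∀ X W : EuclideanSpace ℝ (Fin 4),
      g.val ((extChartAt (𝓡 4) p).symm y)
        (mfderiv 𝓘(ℝ, EuclideanSpace ℝ (Fin 4)) (𝓡 4) (extChartAt (𝓡 4) p).symm y X)
        (mfderiv 𝓘(ℝ, EuclideanSpace ℝ (Fin 4)) (𝓡 4) (extChartAt (𝓡 4) p).symm y W) = ⟪X, W⟫)
    (hGchart : ∀ y ∈ Metric.closedBall (extChartAt (𝓡 4) p p) r, y ≠ extChartAt (𝓡 4) p p →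
      G ((extChartAt (𝓡 4) p).symm y) = a / ‖y - extChartAt (𝓡 4) p p‖ ^ 2 + b)
    {K : ℝ} (hK : 0 < K) {ψ : M → ℝ} (hψ : ∀ x, x ≠ p → ψ x = 4 * K * G x / (4 * K + G x))
    {y : EuclideanSpace ℝ (Fin 4)} (hy : y ∈ Metric.ball (extChartAt (𝓡 4) p p) r)
    (hy0 : y ≠ extChartAt (𝓡 4) p p) :
    12 * a ^ 2 / (K * (a + b * ‖y - extChartAt (𝓡 4) p p‖ ^ 2) ^ 3) ≤
      (ψ ((extChartAt (𝓡 4) p).symm y) ^ 3)⁻¹ *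
        (g.scalarCurvature ((extChartAt (𝓡 4) p).symm y) * ψ ((extChartAt (𝓡 4) p).symm y) -
          6 * g.dalembertian ψ ((extChartAt (𝓡 4) p).symm y)) := by
  set φ := extChartAt (𝓡 4) p with hφ
  have hyc : y ∈ Metric.closedBall (φ p) r := Metric.ball_subset_closedBall hy
  have hyt : y ∈ φ.target := hball hyc
  have hxp : φ.symm y ≠ p := extChartAt_symm_ne_pole hyt hy0
  have hGx : ContMDiffAt (𝓡 4) 𝓘(ℝ, ℝ) ∞ G (φ.symm y) := contMDiffAt_green hGs hxp
  have hG2 : ContMDiffAt (𝓡 4) 𝓘(ℝ, ℝ) 2 G (φ.symm y) := hGx.of_le (WithTop.coe_le_coe.mpr le_top)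
  have hGy : 0 < G (φ.symm y) := hGpos _ hxp
  have h4K : 4 * K + G (φ.symm y) ≠ 0 := by positivity
  have hev : ψ =ᶠ[𝓝 (φ.symm y)] ((fun s : ℝ ↦ 4 * K - 16 * K ^ 2 * (4 * K + s)⁻¹) ∘ G) := by
    filter_upwards [isOpen_compl_singleton.mem_nhds hxp] with z hz
    have hz' : z ≠ p := hz
    have h4Kz : 4 * K + G z ≠ 0 := by have := hGpos z hz'; positivity
    rw [hψ z hz', Function.comp_apply, theta_eq h4Kz]
  have hΔ : g.dalembertian ψ (φ.symm y) =
      deriv (deriv (fun s : ℝ ↦ 4 * K - 16 * K ^ 2 * (4 * K + s)⁻¹)) (G (φ.symm y)) *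
          g.gradSq G (φ.symm y) +
        deriv (fun s : ℝ ↦ 4 * K - 16 * K ^ 2 * (4 * K + s)⁻¹) (G (φ.symm y)) *
          g.dalembertian G (φ.symm y) := by
    rw [g.dalembertian_congr_of_eventuallyEq hev,
      g.dalembertian_real_comp hG2 (contDiffAt_theta h4K 2)]
    rfl
  have hgrad : g.gradSq G (φ.symm y) = 4 * a ^ 2 / (‖y - φ p‖ ^ 2) ^ 3 := by
    rw [gradSq_extChartAt_symm_of_flat g p hyt (hflat y hyc) (hGx.mdifferentiableAt (by simp))]
    have hev2 : (G ∘ φ.symm) =ᶠ[𝓝 y] fun z ↦ a / ‖z - φ p‖ ^ 2 + b := by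
      have hopen : IsOpen (Metric.ball (φ p) r \ {φ p}) :=
        Metric.isOpen_ball.sdiff isClosed_singleton
      filter_upwards [hopen.mem_nhds ⟨hy, hy0⟩] with z hz
      exact hGchart z (Metric.ball_subset_closedBall hz.1) hz.2
    have hconst : gradient (fun z ↦ a / ‖z - φ p‖ ^ 2 + b) y =
        gradient (fun z ↦ a / ‖z - φ p‖ ^ 2) y := by
      rw [gradient, gradient, fderiv_add_const]
    rw [hev2.gradient_eq, hconst, norm_gradient_div_norm_sq a hy0]
  have hΔG : g.dalembertian G (φ.symm y) = g.scalarCurvature (φ.symm y) * G (φ.symm y) / 6 := by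
    have := hGreen _ hxp
    linarith
  have hn : 0 < ‖y - φ p‖ ^ 2 := by
    have : y - φ p ≠ 0 := sub_ne_zero.2 hy0
    positivity
  rw [hΔ, deriv_deriv_theta h4K, deriv_theta, hΔG, hgrad, hψ _ hxp, hGchart y hyc hy0]
  exact cap_algebra_mass hK ha hb hn (hR _)

end Cap

end SphereSideClauseSchwarzschild

/-- **Registered helper `helper_sphereSideCurvBoundSchwarzschild` of stub
`stub_sphereSideClauseSchwarzschild`** (helper file of line `green-blowup-conformal-entropy`,
reshape R-c3, crux stmt-SmoothPoincare4-10871): in the flat gauge with mass at `p`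
(`G ∘ φ⁻¹ = a/‖y−y₀‖² + b` on the punctured closed ball, `a > 0`, `b ≥ 0`), for `R_g ≥ 0`, Green
data off `p` and `ψ = 4KG/(4K+G)` off `p`, the curvature weight satisfies
`ψ⁻³ (R_g ψ − 6 Δ_g ψ) ≥ 12a²/(K(a + b‖y − y₀‖²)³)` on the punctured open chart ball
(`SphereSideClauseSchwarzschild.curv_bound_mass`). [folklore] -/
theorem helper_sphereSideCurvBoundSchwarzschild :
    ∀ (M : Type) [TopologicalSpace M] [T2Space M] [SecondCountableTopology M]
      [ChartedSpace (EuclideanSpace ℝ (Fin 4)) M] [IsManifold (𝓡 4) ∞ M] [CompactSpace M]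
      [T3Space M] [MeasurableSpace M] [BorelSpace M]
      (g : PseudoRiemannianMetric (𝓡 4) ∞ (EuclideanSpace ℝ (Fin 4)) (TangentSpace (𝓡 4) : M → Type _))
      [g.HasLeviCivita], (∀ x, 0 ≤ g.scalarCurvature x) →
      ∀ (p : M) (G : M → ℝ), ContMDiffOn (𝓡 4) 𝓘(ℝ, ℝ) ∞ G {p}ᶜ → (∀ x, x ≠ p → 0 < G x) →
        (∀ x, x ≠ p → g.scalarCurvature x * G x - 6 * g.dalembertian G x = 0) →
      ∀ (a b r : ℝ), 0 < a → 0 ≤ b →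
        Metric.closedBall (extChartAt (𝓡 4) p p) r ⊆ (extChartAt (𝓡 4) p).target →
        (∀ y ∈ Metric.closedBall (extChartAt (𝓡 4) p p) r, ∀ X W : EuclideanSpace ℝ (Fin 4),
          g.val ((extChartAt (𝓡 4) p).symm y)
            (mfderiv 𝓘(ℝ, EuclideanSpace ℝ (Fin 4)) (𝓡 4) (extChartAt (𝓡 4) p).symm y X)
            (mfderiv 𝓘(ℝ, EuclideanSpace ℝ (Fin 4)) (𝓡 4) (extChartAt (𝓡 4) p).symm y W) = ⟪X, W⟫) →
        (∀ y ∈ Metric.closedBall (extChartAt (𝓡 4) p p) r, y ≠ extChartAt (𝓡 4) p p →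
          G ((extChartAt (𝓡 4) p).symm y) = a / ‖y - extChartAt (𝓡 4) p p‖ ^ 2 + b) →
      ∀ (K : ℝ), 0 < K → ∀ (ψ : M → ℝ), (∀ x, x ≠ p → ψ x = 4 * K * G x / (4 * K + G x)) →
      ∀ y ∈ Metric.ball (extChartAt (𝓡 4) p p) r, y ≠ extChartAt (𝓡 4) p p →
        12 * a ^ 2 / (K * (a + b * ‖y - extChartAt (𝓡 4) p p‖ ^ 2) ^ 3) ≤
          (ψ ((extChartAt (𝓡 4) p).symm y) ^ 3)⁻¹ *
            (g.scalarCurvature ((extChartAt (𝓡 4) p).symm y) * ψ ((extChartAt (𝓡 4) p).symm y) -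
              6 * g.dalembertian ψ ((extChartAt (𝓡 4) p).symm y)) := by
  intro M _ _ _ _ _ _ _ _ _ g _ hR p G hGs hGpos hGreen a b r ha hb hball hflat hGchart K hK ψ hψ y
    hy hy0
  exact SphereSideClauseSchwarzschild.curv_bound_mass g hR hGs hGpos hGreen ha hb hball hflat
    hGchart hK hψ hy hy0

end Summit.SmoothPoincare4.SmoothPoincare4.Theorems

end
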